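/-
Copyright (c) 2026 the pub-hodgecm-mathlib formalisation cell (harness21).  Prover seat hodgecm-mathlib-A-p19 (g24) — (U) road, FINAL LINE, 2026-09-01.
-/
import Summits.HodgeConjecture.HodgeConjecture.Theorems.F0P3ArchTopFormWallCompatible   -- ★ p844462 U4: `ArchTopFormWallCompatible L` (brings ★ U5 p844390 + ★ U1′ p844433)
import Literature.NumberTheory.Weil1964.UnitaryArchCentralizerTopFormHaarBridge          -- ★ p844593 U3 «BRIDGE»: `centralizerTopFormHaar_archDiagTorus_eq_map_pi_wallBlock`
import HarnessLib

/-!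
# (U) ROAD — THE FINAL LINE: `ArchTopFormWallCompatible L` ⟹ the universal archimedean pin ratio (U) (the closer's `stub_U` body), with `K := V ^ #places`

Cell `pub/hodgecm-mathlib`, F0∕P3a, crux H413 (`stmt-HodgeConjecture-24833`, `--supports … --as helper`); namespace
`Summit.HodgeConjecture.HodgeConjecture.Cruxes.H413.F0P3ArchUniversalPinRatioOfWallCompatible`.  ONE THEOREM (kernel lane), no def, no `sorry`.  The (U) road
(owner A-p19 (g24), card `ROAD-U-v1`; LEAD F0P3a-plan (g10) WORDS T9-32 (4), T9-34 (2), T9-36, T9-37 (3); ruling R-U1): U1 (A-p06 g28: ★ p844327 ∕ p844350 ∕ p844375),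
U2 (A-p06 + A-p12 g20: ★ p844404 ∕ p844446 ∕ p844348 ∕ p844487 ∕ p844510), (b5) ED. 2 + frame places (F0P3-p03 g11: ★ p844549 ∕ p844365), U1′ ★ p844433, U3a ★ p844507,
U3 BRIDGE ★ p844593, U4 ★ p844462, U5 ★ p844390 — ALL ★; this file composes them.
**`archSingularUniversalPinRatio_of_wallCompatible (h4 : ArchTopFormWallCompatible L) : ‹(U)›`** — the TYPE is the closer's `stub_U` body at `L` (= ★ W8 p844326's binder `hU`,
= the bounced p844247's def body) token for token; the closer edition folds `stub_U := archSingularUniversalPinRatio_of_wallCompatible L stub_WallCompat` (T9-36 (3)); books: row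
«(U)» ↦ CLOSED-DERIVED over the in-house normalisation statement U4 `ArchTopFormWallCompatible` (T9-37 (3): «in-house statement (normalisation), not print»), net 0.
HONEST LABEL: HC_CM is proved only modulo the 2 remaining named inputs (hLiu418 24832, h413 24833) until rung 0 closes; (U) is now CONDITIONAL ONLY on U4 (whose discharge — the
values `vol^TF(U(2))·vol^TF(U(1))` and the Harish-Chandra constant of the top-form measures, motivated by Rogawski 1990 §8.2 p. 119 and §1.7 p. 6 — is a later brick).
-/

set_option autoImplicit false
set_option linter.dupNamespace false

noncomputable section

open MeasureTheory Measure Set Filter Topology NumberField NumberField.InfinitePlace NumberField.mixedEmbedding Matrix Equiv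
open Literature.MeasureTheory.Group Literature.NumberTheory.Automorphic Literature.NumberTheory.Automorphic.UnitaryGroup
open Literature.NumberTheory.Weil1964 Literature.NumberTheory.Weil1964.UnitaryArchTopForm Literature.NumberTheory.Weil1964.UnitaryArchLocalTopForm
open Literature.NumberTheory.Rogawski1990
open scoped ENNReal NNReal Classical Matrix MatrixGroups Matrix.Norms.Operator ContDiff ComplexConjugate

namespace Summit.HodgeConjecture.HodgeConjecture.Cruxes.H413.F0P3ArchUniversalPinRatioOfWallCompatible

open Summit.HodgeConjecture.HodgeConjecture.Cruxes.H413.F0P3ArchTopFormWallCompatible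

set_option maxHeartbeats 800000 in
/-- **THE UNIVERSAL ARCHIMEDEAN PIN RATIO (U) FROM THE IN-HOUSE NORMALISATION STATEMENT U4.**  `ArchTopFormWallCompatible L` (one `V ≠ 0`: top-form wall-block mass `V` at compact
walls, (J-nc) constant `−V` at noncompact walls) ⟹ the (U) text of record (★ W8's `hU`, the closer's `stub_U` body): ★ U5 `archSingularUniversalPinRatio_of_wallCompatible_of_bridge`
at the U1 block family `archLocalTopFormHaar` (Haar by ★ U1′), (COMPAT) := `h4`'s conjuncts, (BRIDGE) := ★ U3 `centralizerTopFormHaar_archDiagTorus_eq_map_pi_wallBlock`; Borel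
σ-algebras on `GL₂(ℂ)`, `GL₁(ℂ)` chosen inside.  `K = V ^ Fintype.card {w ∕∕ IsComplex w}`.  (in-house; motivated by Rogawski 1990 §8.2 p. 119, §1.7 p. 6) -/
theorem archSingularUniversalPinRatio_of_wallCompatible (L : Type) [Field L] [NumberField L] [IsCMField L]
    (h4 : ArchTopFormWallCompatible L) :
    ∀ [MeasurableSpace (GL (Fin 3) ℂ)] [BorelSpace (GL (Fin 3) ℂ)]
    (α' : Fin 3 → L) (_hα' : ∀ i, α' i ≠ 0) (_hhermα : ∀ i, (IsCMField.complexConj L (α' i) : L) = α' i)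
    [MeasurableSpace (arch (↥(maximalRealSubfield L)) L (IsCMField.complexConj L) 3 (Matrix.diagonal α'))] [BorelSpace (arch (↥(maximalRealSubfield L)) L (IsCMField.complexConj L) 3 (Matrix.diagonal α'))]
    (z₁ : {w : InfinitePlace L // IsComplex w} → Fin 3 → Circle) (h02 : ∀ w, z₁ w 0 = z₁ w 2) (h01 : ∀ w, z₁ w 0 ≠ z₁ w 1)
    [∀ (w : {w : InfinitePlace L // IsComplex w}) (τ : Perm (Fin 3)), MeasurableSpace (archLocal L 3 (Matrix.diagonal (α' ∘ ⇑τ)) w ⧸ Subgroup.centralizer ({(⟨circleDiagonal 3 (z₁ w), circleDiagonal_mem_archLocal_diagonal L 3 (α' ∘ ⇑τ) w (z₁ w)⟩ : archLocal L 3 (Matrix.diagonal (α' ∘ ⇑τ)) w)} : Set (archLocal L 3 (Matrix.diagonal (α' ∘ ⇑τ)) w)))]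
    [∀ (w : {w : InfinitePlace L // IsComplex w}) (τ : Perm (Fin 3)), BorelSpace (archLocal L 3 (Matrix.diagonal (α' ∘ ⇑τ)) w ⧸ Subgroup.centralizer ({(⟨circleDiagonal 3 (z₁ w), circleDiagonal_mem_archLocal_diagonal L 3 (α' ∘ ⇑τ) w (z₁ w)⟩ : archLocal L 3 (Matrix.diagonal (α' ∘ ⇑τ)) w)} : Set (archLocal L 3 (Matrix.diagonal (α' ∘ ⇑τ)) w)))],
    ∃ K : ℝ≥0, K ≠ 0 ∧
    ∀ (νH : ∀ (w : {w : InfinitePlace L // IsComplex w}) (τ : Perm (Fin 3)), Measure (Subgroup.centralizer ({(⟨circleDiagonal 3 (z₁ w), circleDiagonal_mem_archLocal_diagonal L 3 (α' ∘ ⇑τ) w (z₁ w)⟩ : archLocal L 3 (Matrix.diagonal (α' ∘ ⇑τ)) w)} : Set (archLocal L 3 (Matrix.diagonal (α' ∘ ⇑τ)) w))))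
        (hνH : ∀ w τ, (νH w τ).IsHaarMeasure ∧ (νH w τ).IsInvInvariant)
        (hpin : ∀ (w : {w : InfinitePlace L // IsComplex w}) (τ : Perm (Fin 3)), (w.1.embedding (α' (τ 0))).re * (w.1.embedding (α' (τ 2))).re < 0 →
        haveI : LocallyCompactSpace (archLocal L 3 (Matrix.diagonal (α' ∘ ⇑τ)) w) := locallyCompactSpace_archLocal L 3 (Matrix.diagonal (α' ∘ ⇑τ)) w
        haveI : SecondCountableTopology (archLocal L 3 (Matrix.diagonal (α' ∘ ⇑τ)) w) := secondCountableTopology_archLocal L 3 (Matrix.diagonal (α' ∘ ⇑τ)) w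
        haveI : (νH w τ).IsHaarMeasure := (hνH w τ).1
        haveI : (νH w τ).IsInvInvariant := (hνH w τ).2
        ∃ (ν : Measure (archLocal L 3 (Matrix.diagonal (α' ∘ ⇑τ)) w)) (_ : ν.IsHaarMeasure) (_ : ν.IsMulRightInvariant),
          ∀ (Θ : Matrix (Fin 3) (Fin 3) ℂ → ℂ), ContDiff ℝ (⊤ : ℕ∞) Θ →
            HasCompactSupport (fun k : archLocal L 3 (Matrix.diagonal (α' ∘ ⇑τ)) w => Θ ((k : GL (Fin 3) ℂ) : Matrix (Fin 3) (Fin 3) ℂ)) →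
            ∀ (z₀ : Fin 3 → Circle) (h02' : z₀ 0 = z₀ 2) (h01' : z₀ 0 ≠ z₀ 1),
              Tendsto (fun ψ : ℝ => deriv (fun ψ : ℝ => (2 * Real.sin ψ : ℂ) *
                  ∫ g, Θ (((g * ⟨circleDiagonal 3 (fun i => z₀ i * Circle.exp (![(1 : ℝ), 0, -1] i * ψ)),
                    circleDiagonal_mem_archLocal_diagonal L 3 (α' ∘ ⇑τ) w _⟩ * g⁻¹ : archLocal L 3 (Matrix.diagonal (α' ∘ ⇑τ)) w) : GL (Fin 3) ℂ) : Matrix (Fin 3) (Fin 3) ℂ) ∂(ν)) ψ)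
                (𝓝[≠] 0)
                (𝓝 ((-1 : ℂ) * ∫ y, descConj (⟨circleDiagonal 3 z₀, circleDiagonal_mem_archLocal_diagonal L 3 (α' ∘ ⇑τ) w z₀⟩ : archLocal L 3 (Matrix.diagonal (α' ∘ ⇑τ)) w)
                  (Subgroup.centralizer ({(⟨circleDiagonal 3 (z₁ w), circleDiagonal_mem_archLocal_diagonal L 3 (α' ∘ ⇑τ) w (z₁ w)⟩ : archLocal L 3 (Matrix.diagonal (α' ∘ ⇑τ)) w)} : Set (archLocal L 3 (Matrix.diagonal (α' ∘ ⇑τ)) w)))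
                  (forall_mem_centralizer_circleDiagonal_comm_of_wall L (α' ∘ ⇑τ) w (h02 w) (h01 w) h02' h01')
                  (fun k : archLocal L 3 (Matrix.diagonal (α' ∘ ⇑τ)) w => Θ ((k : GL (Fin 3) ℂ) : Matrix (Fin 3) (Fin 3) ℂ)) y
                  ∂(quotientMeasure _ (νH w τ) (isClosed_coe_centralizer_singleton _) (ν)))))
        (z : {w : InfinitePlace L // IsComplex w} → Fin 3 → Circle) (hwall : ∀ w, z w 0 = z w 2 ∧ z w 0 ≠ z w 1)
        (_hrat : ∃ a b : L, ∀ w : {w : InfinitePlace L // IsComplex w}, ((z w 0 : ℂ) = w.1.embedding a) ∧ ((z w 1 : ℂ) = w.1.embedding b))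
        (ρ : {w : InfinitePlace L // IsComplex w} → Perm (Fin 3))
        (ρZ : ∀ (w : {w : InfinitePlace L // IsComplex w}) (σ : Perm (Fin 3)), Measure (Subgroup.centralizer ({(⟨circleDiagonal 3 (z w ∘ ⇑σ), circleDiagonal_mem_archLocal_diagonal L 3 α' w (z w ∘ ⇑σ)⟩ : archLocal L 3 (Matrix.diagonal α') w)} : Set (archLocal L 3 (Matrix.diagonal α') w))))
        (_hρZi : ∀ w σ, (ρZ w σ).IsHaarMeasure ∧ (ρZ w σ).IsInvInvariant)
        (_hρZ : ∀ (w : {w : InfinitePlace L // IsComplex w}) (σ : Perm (Fin 3)), ¬ 0 < (w.1.embedding (α' (σ⁻¹ 0))).re * (w.1.embedding (α' (σ⁻¹ 2))).re →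
          ρZ w σ = (νH w σ⁻¹).map (subgroupCongrHomeomorph (ContinuousMulEquiv.restrictSubgroup (GLn.conjEquiv (Matrix.GeneralLinearGroup.mkOfDetNeZero _ (det_monomial_one_ne_zero 3 σ⁻¹))) (archLocal L 3 (Matrix.diagonal (α' ∘ ⇑σ⁻¹)) w) (archLocal L 3 (Matrix.diagonal α') w) (mem_archLocal_comp_perm_iff_conj_mem L 3 α' w σ⁻¹)).toMulEquiv
        (Subgroup.centralizer ({(⟨circleDiagonal 3 (z₁ w), circleDiagonal_mem_archLocal_diagonal L 3 (α' ∘ ⇑σ⁻¹) w (z₁ w)⟩ : archLocal L 3 (Matrix.diagonal (α' ∘ ⇑σ⁻¹)) w)} : Set (archLocal L 3 (Matrix.diagonal (α' ∘ ⇑σ⁻¹)) w)))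
        (Subgroup.centralizer ({(⟨circleDiagonal 3 (z w ∘ ⇑σ), circleDiagonal_mem_archLocal_diagonal L 3 α' w (z w ∘ ⇑σ)⟩ : archLocal L 3 (Matrix.diagonal α') w)} : Set (archLocal L 3 (Matrix.diagonal α') w)))
        (relabel_inv_mem_centralizer_circleDiagonal_comp_iff L α' w σ (h02 w) (h01 w) (hwall w).1 (hwall w).2)
        (ContinuousMulEquiv.restrictSubgroup (GLn.conjEquiv (Matrix.GeneralLinearGroup.mkOfDetNeZero _ (det_monomial_one_ne_zero 3 σ⁻¹))) (archLocal L 3 (Matrix.diagonal (α' ∘ ⇑σ⁻¹)) w) (archLocal L 3 (Matrix.diagonal α') w) (mem_archLocal_comp_perm_iff_conj_mem L 3 α' w σ⁻¹)).continuous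
        (ContinuousMulEquiv.restrictSubgroup (GLn.conjEquiv (Matrix.GeneralLinearGroup.mkOfDetNeZero _ (det_monomial_one_ne_zero 3 σ⁻¹))) (archLocal L 3 (Matrix.diagonal (α' ∘ ⇑σ⁻¹)) w) (archLocal L 3 (Matrix.diagonal α') w) (mem_archLocal_comp_perm_iff_conj_mem L 3 α' w σ⁻¹)).symm.continuous))
        (_hρZ1 : ∀ (w : {w : InfinitePlace L // IsComplex w}) (σ : Perm (Fin 3)), 0 < (w.1.embedding (α' (σ⁻¹ 0))).re * (w.1.embedding (α' (σ⁻¹ 2))).re → ρZ w σ Set.univ = 1)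
        (ρP : Measure (Subgroup.pi Set.univ (fun w : {w : InfinitePlace L // IsComplex w} => Subgroup.centralizer ({(⟨circleDiagonal 3 (z w ∘ ⇑(ρ w)), circleDiagonal_mem_archLocal_diagonal L 3 α' w (z w ∘ ⇑(ρ w))⟩ : archLocal L 3 (Matrix.diagonal α') w)} : Set (archLocal L 3 (Matrix.diagonal α') w)))))
        (_hρP : Measure.map (subgroupPiCoords fun w : {w : InfinitePlace L // IsComplex w} => Subgroup.centralizer ({(⟨circleDiagonal 3 (z w ∘ ⇑(ρ w)), circleDiagonal_mem_archLocal_diagonal L 3 α' w (z w ∘ ⇑(ρ w))⟩ : archLocal L 3 (Matrix.diagonal α') w)} : Set (archLocal L 3 (Matrix.diagonal α') w))) ρP = Measure.pi fun w => ρZ w (ρ w))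
        (ρ' : Measure (Subgroup.centralizer ({archDiagTorus L 3 α' (fun w => z w ∘ ⇑(ρ w))} : Set (arch (↥(maximalRealSubfield L)) L (IsCMField.complexConj L) 3 (Matrix.diagonal α')))))
        (_hρ' : ρ' = ρP.map (subgroupCongrHomeomorph (archPiEquivCM 3 L (Matrix.diagonal α')).symm.toMulEquiv (Subgroup.pi Set.univ (fun w : {w : InfinitePlace L // IsComplex w} => Subgroup.centralizer ({(⟨circleDiagonal 3 (z w ∘ ⇑(ρ w)), circleDiagonal_mem_archLocal_diagonal L 3 α' w (z w ∘ ⇑(ρ w))⟩ : archLocal L 3 (Matrix.diagonal α') w)} : Set (archLocal L 3 (Matrix.diagonal α') w)))) (Subgroup.centralizer ({archDiagTorus L 3 α' (fun w => z w ∘ ⇑(ρ w))} : Set (arch (↥(maximalRealSubfield L)) L (IsCMField.complexConj L) 3 (Matrix.diagonal α')))) (apply_mem_centralizer_iff_mem_pi_centralizer _ (archPiEquivCM 3 L (Matrix.diagonal α')).symm.toMulEquiv (archPiEquivCM_symm_circleDiagonal_eq_archDiagTorus L 3 α' (fun w => z w ∘ ⇑(ρ w)))) (archPiEquivCM 3 L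 (Matrix.diagonal α')).symm.continuous (archPiEquivCM 3 L (Matrix.diagonal α')).continuous)),
        centralizerTopFormHaar L (Matrix.diagonal α') (archDiagTorus L 3 α' (fun w => z w ∘ ⇑(ρ w))) = K • ρ'  := by
  obtain ⟨V, hV, hcpt, hnc⟩ := h4
  letI i2 : MeasurableSpace (GL (Fin 2) ℂ) := borel _
  haveI i2b : BorelSpace (GL (Fin 2) ℂ) := ⟨rfl⟩
  letI i1 : MeasurableSpace (GL (Fin 1) ℂ) := borel _
  haveI i1b : BorelSpace (GL (Fin 1) ℂ) := ⟨rfl⟩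
  intro iG iGb
  exact archSingularUniversalPinRatio_of_wallCompatible_of_bridge L (fun b w => archLocalTopFormHaar L 2 (Matrix.diagonal b) w)
    (fun b w => archLocalTopFormHaar L 1 (Matrix.diagonal b) w)
    (fun b w hb hbr => isHaarMeasure_archLocalTopFormHaar_diagonal L 2 w b hb hbr) (fun b w hb hbr => isHaarMeasure_archLocalTopFormHaar_diagonal L 1 w b hb hbr) V hV
    (fun w β hβ hh z₁ h02 h01 hpos => hcpt w β hβ hh z₁ h02 h01 hpos)
    (fun w β hβ hh z₁ h02 h01 _ _ hlt => hnc w β hβ hh z₁ h02 h01 hlt)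
    (fun α' hα' hh _ _ z₁ h02 h01 z hwall hrat ρ =>
      centralizerTopFormHaar_archDiagTorus_eq_map_pi_wallBlock L α' hα' hh z₁ h02 h01 z hwall hrat ρ)

end Summit.HodgeConjecture.HodgeConjecture.Cruxes.H413.F0P3ArchUniversalPinRatioOfWallCompatible

end
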